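import Summits.HubbardSuperconductivity.HubbardSuperconductivity.Theorems.AnisotropyChordTransferFibre3N1RowObjQSums

/-!
# Route `AnisotropyChord` / H0 rotor rung, LEVEL 2 row `N₁`: the OBJECT `Q̂₁ = θ⁴Σ_eΣ_k |φ̂_e(k)|² F₂(k)` lies in its `RExpr` bracket

Fourth instance of the object layer (after `P̂`, `Â`, `B̂`): for a ground two-magnon profile (`L ≥ 16`, `0 ≤ Δ < 1`) and the true
vector `X = xTrue L Δ λ₂ f a` (`a = Δf(x̂)`, `t = θ²`), with `nK k := Σ_{e ∈ nn} |φ̂_e(k)|²`,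
★ `q1Hat_mem`: `(Q1lo 2).eval X ≤ t²·Σ_k nK(k) F₂(k) ≤ (Q1hi 2).eval X`  (`⟨Π⁰,C0⟩ = −(3/2)·Q̂₁/(4π²t)` by `PiC0OneLoop`).
Pieces: `k = 0` (`eval_Q1zero`: `φ̂_e(0) = γ`, `PhiHatClosedPlusTail`), the block `|q|∞ ≤ 2` termwise through the kernel bounds of
`…N1RowObjQKernel` (`qBlock_bounds`, products with the sign-indefinite `F̂` by `min/max`), the closed outer part
`t²(Σ_{k≠0} Mc − Σ_{block} Mc)` (`eval_Q1closedFull`, `eval_M1`) and the outer tail `OuterMaj.pc0_outer_bound` (`m₀ = 13/10`,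
repaired slope `κ̂′`) against `Q1tail = max(vD − block, 0) + max(vY − block, 0)` (`eval_vDfull`, `eval_vYfull`, `eval_YR1`, `eval_acx`).
Prover seat `hubbard-h0-rotor-p2` g5; helper for piece A = stmt-HubbardSuperconductivity-23918 of rung 19089
(`--supports`, helper class).  Nothing here proves superconductivity in the Hubbard model; helper lemmas of ONE conditional
reduction (the GM₃ ∀L certificate, Level-2 row `N₁`); the rotor TARGET as originally worded stays FALSE (g15 verdict).
Mathlib + the tree only; no sorry.
-/

set_option linter.dupNamespace false
set_option autoImplicit false

open Literature.Analysis.ValidatedNumerics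

namespace Summit.HubbardSuperconductivity.HubbardSuperconductivity.Theorems.AnisotropyChord.Transfer.Fibre3.L2.N1

variable (L : ℕ) [NeZero L] (Δ lam2 : ℝ) (f : Tor L → ℝ)

/-- the direction-summed energy-current kernel `nK(k) = Σ_{e ∈ nn} |φ̂_e(k)|²`. -/
noncomputable def nK (k : Tor L) : ℝ := ((nnList L).map (fun e => Complex.normSq (phiHat L f e k))).sum

/-! ## Interval products with a sign-indefinite factor -/

/-- `x ∈ [lo, hi] ⇒ min(lo·c, hi·c) ≤ x·c`. -/
theorem min_mul_le {lo hi x : ℝ} (h1 : lo ≤ x) (h2 : x ≤ hi) (c : ℝ) : min (lo * c) (hi * c) ≤ x * c := by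
  by_cases hc : 0 ≤ c
  · exact (min_le_left _ _).trans (mul_le_mul_of_nonneg_right h1 hc)
  · exact (min_le_right _ _).trans (mul_le_mul_of_nonpos_right h2 (le_of_lt (not_le.1 hc)))

/-- `x ∈ [lo, hi] ⇒ x·c ≤ max(lo·c, hi·c)`. -/
theorem mul_le_max {lo hi x : ℝ} (h1 : lo ≤ x) (h2 : x ≤ hi) (c : ℝ) : x * c ≤ max (lo * c) (hi * c) := by
  by_cases hc : 0 ≤ c
  · exact (mul_le_mul_of_nonneg_right h2 hc).trans (le_max_right _ _)
  · exact (mul_le_mul_of_nonpos_right h1 (le_of_lt (not_le.1 hc))).trans (le_max_left _ _)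

/-! ## The special point `k = 0` -/

/-- `nK(0) = 4γ²` (`φ̂_e(0) = γ` for the four directions). -/
theorem nK_zero (hL : 5 ≤ L) (hΔ0 : 0 ≤ Δ) (hf : IsGroundTwoMagnon L Δ lam2 f) (hlam : 0 < lam2) :
    nK L f 0 = 4 * gamPar L Δ lam2 f ^ 2 := by
  have hγ : ∀ e ∈ nnList L, Complex.normSq (phiHat L f e 0) = gamPar L Δ lam2 f ^ 2 := by
    intro e he
    rw [(OuterMaj.phiHatClosedPlusTail_holds L hL hΔ0 lam2 f hf hlam e he).1, Complex.normSq_ofReal]; ring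
  unfold nK
  rw [List.map_congr_left hγ]
  simp [nnList]
  ring

/-- ★ `Q1zero ↦ t²·nK(0)·F₂(0)` (`γ = λ₂F₂(0)/4 + a(a + η)`, manifold dictionary (iii)). -/
theorem eval_Q1zero (hL : 5 ≤ L) (hΔ0 : 0 ≤ Δ) (hΔ1 : Δ < 1) (hf : IsGroundTwoMagnon L Δ lam2 f) (hlam : 0 < lam2) :
    Q1zero.eval (xTrue L Δ lam2 f (Δ * f (K1 L))) = ((2 * Real.pi / L) ^ 2) ^ 2 * (nK L f 0 * F2 L f 0) := by
  set X := xTrue L Δ lam2 f (Δ * f (K1 L)) with hXdef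
  obtain ⟨_, _, d3, _, _, _, _⟩ := ManifoldA.manifold_dictionary L hL hΔ0 hΔ1 hf
  have hF0 : F0h.eval X = (2 * Real.pi / L) ^ 2 * F2 L f 0 := eval_F0h L Δ lam2 f hL hΔ0 hΔ1 hf hlam
  have he := eval_eta L Δ lam2 f (by omega) (Δ * f (K1 L))
  have hX0 : X 0 = (2 * Real.pi / L) ^ 2 := xTrue_zero L Δ lam2 f _
  have hX2 : X 2 = lam2 / (2 * Real.pi / L) ^ 2 := by rw [hXdef, xTrue_lt16 L Δ lam2 f _ (by norm_num)]; rfl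
  have hX3 : X 3 = Δ * f (K1 L) := by rw [hXdef, xTrue_lt16 L Δ lam2 f _ (by norm_num)]; rfl
  have h0 := (OuterMaj.f2ClosedPlusTail_holds L hL hΔ0 lam2 f hf hlam).1
  have hLpos : (0 : ℝ) < L := by exact_mod_cast (show 0 < L by omega)
  have hθ2 : (2 * Real.pi / (L : ℝ)) ^ 2 ≠ 0 := by positivity
  rw [nK_zero L Δ lam2 f hL hΔ0 hf hlam]
  have e : Q1zero.eval X = X 0 * (X 2 * F0h.eval X + 4 * X 3 * (X 3 + eta.eval X)) ^ 2 * F0h.eval X * (1 / 4) := by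
    simp only [Q1zero, RExpr.eval, cst, vT, vNu, vA]; push_cast; ring
  rw [e, hF0, he, hX0, hX2, hX3]
  unfold gamPar
  rw [h0, d3]
  field_simp

/-! ## The block -/

/-- ★ per block momentum: `qBlockLo.eval X ≤ t²·nK(k)F₂(k) ≤ qBlockHi.eval X` (`k = toTor q`, `|q|∞ ≤ 2`). -/
theorem qBlock_bounds (hL : 7 ≤ L) (hΔ0 : 0 ≤ Δ) (hΔ1 : Δ < 1) (hf : IsGroundTwoMagnon L Δ lam2 f) (hlam : 0 < lam2)
    {q : ℤ × ℤ} (hq : q ∈ gridPts 2) :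
    (qBlockLo 3 q).eval (xTrue L Δ lam2 f (Δ * f (K1 L)))
        ≤ ((2 * Real.pi / L) ^ 2) ^ 2 * (nK L f (B1.toTor L q) * F2 L f (B1.toTor L q)) ∧
    ((2 * Real.pi / L) ^ 2) ^ 2 * (nK L f (B1.toTor L q) * F2 L f (B1.toTor L q))
        ≤ (qBlockHi 3 q).eval (xTrue L Δ lam2 f (Δ * f (K1 L))) := by
  set X := xTrue L Δ lam2 f (Δ * f (K1 L)) with hXdef
  set t : ℝ := (2 * Real.pi / L) ^ 2 with ht
  set k := B1.toTor L q with hk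
  have hq3 : q ∈ gridPts 3 := gridPts_two_sub q hq
  have hFh : (Fh 3 q).eval X = t * F2 L f k := eval_Fh L Δ lam2 f (by omega) hΔ0 hΔ1 hf hlam hq3
  have hker : ∀ e ∈ E4, (kerLo 3 q e).eval X ≤ t * Complex.normSq (phiHat L f (B1.toTor L e) k) ∧
      t * Complex.normSq (phiHat L f (B1.toTor L e) k) ≤ (kerHi 3 q e).eval X :=
    fun e he => ker_bounds L Δ lam2 f hL hΔ0 hΔ1 hf hlam hq3 he
  have htrue : t ^ 2 * (nK L f k * F2 L f k)
      = (E4.map fun e => t * Complex.normSq (phiHat L f (B1.toTor L e) k) * (t * F2 L f k)).sum := by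
    unfold nK
    rw [nnList_eq_map]
    simp only [E4, List.map_cons, List.map_nil, List.sum_cons, List.sum_nil]
    ring
  constructor
  · have e1 : (qBlockLo 3 q).eval X
        = (E4.map fun e => min ((kerLo 3 q e).eval X * (Fh 3 q).eval X) ((kerHi 3 q e).eval X * (Fh 3 q).eval X)).sum := by
      simp only [qBlockLo, eval_rsum, List.map_map, Function.comp_def, RExpr.eval]
    rw [e1, htrue]
    refine List.sum_le_sum fun e he => ?_
    rw [hFh]
    exact min_mul_le (hker e he).1 (hker e he).2 _
  · have e1 : (qBlockHi 3 q).eval X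
        = (E4.map fun e => max ((kerLo 3 q e).eval X * (Fh 3 q).eval X) ((kerHi 3 q e).eval X * (Fh 3 q).eval X)).sum := by
      simp only [qBlockHi, eval_rsum, List.map_map, Function.comp_def, RExpr.eval]
    rw [e1, htrue]
    refine List.sum_le_sum fun e he => ?_
    rw [hFh]
    exact mul_le_max (hker e he).1 (hker e he).2 _

/-! ## ★ The object `Q̂₁` is in its bracket -/

/-- ★★ **`Q̂₁ = θ⁴Σ_k nK(k) F₂(k) ∈ [Q1lo, Q1hi]` at the true vector** (ground profile, `L ≥ 16`, `0 ≤ Δ < 1`, `c_sG̃(0) > 0`). -/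
theorem q1Hat_mem (hL : 16 ≤ L) (hΔ0 : 0 ≤ Δ) (hΔ1 : Δ < 1) (hf : IsGroundTwoMagnon L Δ lam2 f) (hlam : 0 < lam2)
    (h2 : 2 * lam2 < eps1 L) (hu : 0 < cS L Δ lam2 f * Gzero L lam2) :
    (Q1lo 2).eval (xTrue L Δ lam2 f (Δ * f (K1 L))) ≤ ((2 * Real.pi / L) ^ 2) ^ 2 * ∑ k : Tor L, nK L f k * F2 L f k ∧
    ((2 * Real.pi / L) ^ 2) ^ 2 * ∑ k : Tor L, nK L f k * F2 L f k ≤ (Q1hi 2).eval (xTrue L Δ lam2 f (Δ * f (K1 L))) := by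
  classical
  set X := xTrue L Δ lam2 f (Δ * f (K1 L)) with hXdef
  set t : ℝ := (2 * Real.pi / L) ^ 2 with htdef
  have hLpos : (0 : ℝ) < L := by exact_mod_cast (show 0 < L by omega)
  have ht2 : 0 ≤ t ^ 2 := by positivity
  set E0 := (Finset.univ : Finset (Tor L)).erase 0 with hE0
  set BL := Fibre3.block1 L 2 with hBL
  -- the pieces
  have hzero : Q1zero.eval X = t ^ 2 * (nK L f 0 * F2 L f 0) := eval_Q1zero L Δ lam2 f (by omega) hΔ0 hΔ1 hf hlam
  have hM1ch : ∀ q ∈ gridPts 2, (RExpr.mul (M1 3 q) (ch 3 q)).eval X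
      = t ^ 2 * (MK L Δ lam2 f (B1.toTor L q) * cK L Δ lam2 f (B1.toTor L q)) := by
    intro q hq
    simp only [RExpr.eval]
    rw [eval_M1 L Δ lam2 f (by omega) hΔ0 hΔ1 hf hlam h2 (gridPts_two_sub q hq),
      (eval_closed L Δ lam2 f (by omega) hΔ0 hΔ1 hf hlam (gridPts_two_sub q hq)).1]
    ring
  have hM1g : ∀ q ∈ gridPts 2, (RExpr.mul (M1 3 q) (vG 3 q)).eval X
      = t ^ 2 * (MK L Δ lam2 f (B1.toTor L q) * gres L lam2 (B1.toTor L q)) := by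
    intro q hq
    simp only [RExpr.eval]
    rw [eval_M1 L Δ lam2 f (by omega) hΔ0 hΔ1 hf hlam h2 (gridPts_two_sub q hq), eval_vG L Δ lam2 f (gridPts_two_sub q hq)]
    ring
  have hYZ : ∀ q ∈ gridPts 2, (RExpr.mul (YR1 3 q) (acx 3 q)).eval X
      = t ^ 2 * (YP2 L Δ lam2 f (B1.toTor L q) * acZ L Δ lam2 f (B1.toTor L q)) := by
    intro q hq
    simp only [RExpr.eval]
    rw [eval_YR1 L Δ lam2 f (by omega) hΔ0 hΔ1 hf hlam h2 hu (gridPts_two_sub q hq),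
      eval_acx L Δ lam2 f (by omega) hΔ0 hΔ1 hf hlam h2 hu (gridPts_two_sub q hq)]
    ring
  have hcl : Q1closedFull.eval X = t ^ 2 * ∑ k ∈ E0, MK L Δ lam2 f k * cK L Δ lam2 f k :=
    eval_Q1closedFull L Δ lam2 f (by omega) hΔ0 hΔ1 hf hlam (by linarith) hu
  have hvD : vDfull.eval X = t ^ 2 * (kapP L Δ lam2 f * ∑ k ∈ E0, MK L Δ lam2 f k * gres L lam2 k) :=
    eval_vDfull L Δ lam2 f (by omega) hΔ0 hΔ1 hf hlam h2 hu
  have hvY : vYfull.eval X = t ^ 2 * ∑ k ∈ E0, YP2 L Δ lam2 f k * acZ L Δ lam2 f k :=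
    eval_vYfull L Δ lam2 f (by omega) hΔ0 hΔ1 hf hlam h2 hu
  have hkap : kap.eval X = kapP L Δ lam2 f := by
    rw [hXdef, kap_eval L Δ lam2 f (by omega) hΔ0 hΔ1 hf hlam h2 hu]; rfl
  -- block list sums ↦ Finset sums
  have bC : ((block1 2).map fun q => (RExpr.mul (M1 3 q) (ch 3 q)).eval X).sum
      = t ^ 2 * ∑ k ∈ BL, MK L Δ lam2 f k * cK L Δ lam2 f k := by
    rw [hBL, block1_sum_eq L (by omega), ← List.sum_map_mul_left]
    exact congrArg List.sum (List.map_congr_left fun q hq => hM1ch q hq)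
  have bG : ((block1 2).map fun q => (RExpr.mul (M1 3 q) (vG 3 q)).eval X).sum
      = t ^ 2 * ∑ k ∈ BL, MK L Δ lam2 f k * gres L lam2 k := by
    rw [hBL, block1_sum_eq L (by omega), ← List.sum_map_mul_left]
    exact congrArg List.sum (List.map_congr_left fun q hq => hM1g q hq)
  have bY : ((block1 2).map fun q => (RExpr.mul (YR1 3 q) (acx 3 q)).eval X).sum
      = t ^ 2 * ∑ k ∈ BL, YP2 L Δ lam2 f k * acZ L Δ lam2 f k := by
    rw [hBL, block1_sum_eq L (by omega), ← List.sum_map_mul_left]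
    exact congrArg List.sum (List.map_congr_left fun q hq => hYZ q hq)
  have bLo : ((block1 2).map fun q => (qBlockLo 3 q).eval X).sum ≤ t ^ 2 * ∑ k ∈ BL, nK L f k * F2 L f k := by
    rw [hBL, block1_sum_eq L (by omega), ← List.sum_map_mul_left]
    exact List.sum_le_sum fun q hq => (qBlock_bounds L Δ lam2 f (by omega) hΔ0 hΔ1 hf hlam hq).1
  have bHi : t ^ 2 * ∑ k ∈ BL, nK L f k * F2 L f k ≤ ((block1 2).map fun q => (qBlockHi 3 q).eval X).sum := by
    rw [hBL, block1_sum_eq L (by omega), ← List.sum_map_mul_left]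
    exact List.sum_le_sum fun q hq => (qBlock_bounds L Δ lam2 f (by omega) hΔ0 hΔ1 hf hlam hq).2
  -- the outer parts evaluated
  have eout : (Q1outer 2).eval X = t ^ 2 * (∑ k ∈ E0, MK L Δ lam2 f k * cK L Δ lam2 f k
      - ∑ k ∈ BL, MK L Δ lam2 f k * cK L Δ lam2 f k) := by
    simp only [Q1outer, RExpr.eval, eval_rsum, List.map_map, Nat.reduceAdd]
    have h1 : (List.map ((fun e => e.eval X) ∘ fun q => RExpr.mul (M1 3 q) (ch 3 q)) (block1 2)).sum
        = t ^ 2 * ∑ k ∈ BL, MK L Δ lam2 f k * cK L Δ lam2 f k := by rw [← bC]; rfl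
    rw [hcl, h1]; ring
  set A : ℝ := t ^ 2 * (kapP L Δ lam2 f * (∑ k ∈ E0, MK L Δ lam2 f k * gres L lam2 k
      - ∑ k ∈ BL, MK L Δ lam2 f k * gres L lam2 k)) with hA
  set B : ℝ := t ^ 2 * (∑ k ∈ E0, YP2 L Δ lam2 f k * acZ L Δ lam2 f k - ∑ k ∈ BL, YP2 L Δ lam2 f k * acZ L Δ lam2 f k) with hB
  have etail : (Q1tail 2).eval X = max A 0 + max B 0 := by
    simp only [Q1tail, RExpr.eval, eval_rsum, List.map_map, cst, Nat.reduceAdd]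
    have h1 : (List.map ((fun e => e.eval X) ∘ fun q => RExpr.mul (M1 3 q) (vG 3 q)) (block1 2)).sum
        = t ^ 2 * ∑ k ∈ BL, MK L Δ lam2 f k * gres L lam2 k := by rw [← bG]; rfl
    have h2' : (List.map ((fun e => e.eval X) ∘ fun q => RExpr.mul (YR1 3 q) (acx 3 q)) (block1 2)).sum
        = t ^ 2 * ∑ k ∈ BL, YP2 L Δ lam2 f k * acZ L Δ lam2 f k := by rw [← bY]; rfl
    rw [hvD, hvY, hkap, h1, h2']
    push_cast
    congr 1
    · congr 1; rw [hA]; ring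
    · congr 1; rw [hB]; ring
  have ehi : (Q1hi 2).eval X = Q1zero.eval X + ((block1 2).map fun q => (qBlockHi 3 q).eval X).sum
      + (Q1outer 2).eval X + (Q1tail 2).eval X := by
    simp only [Q1hi, rsum, RExpr.eval, eval_rsum, List.map_map, Nat.reduceAdd]
    have : (List.map ((fun e => e.eval X) ∘ fun q => qBlockHi 3 q) (block1 2)).sum
        = ((block1 2).map fun q => (qBlockHi 3 q).eval X).sum := rfl
    rw [this]; ring
  have elo : (Q1lo 2).eval X = Q1zero.eval X + ((block1 2).map fun q => (qBlockLo 3 q).eval X).sum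
      + (Q1outer 2).eval X - (Q1tail 2).eval X := by
    simp only [Q1lo, rsum, RExpr.eval, eval_rsum, List.map_map, Nat.reduceAdd]
    have : (List.map ((fun e => e.eval X) ∘ fun q => qBlockLo 3 q) (block1 2)).sum
        = ((block1 2).map fun q => (qBlockLo 3 q).eval X).sum := rfl
    rw [this]; ring
  -- the true sum decomposed
  have split := OuterMaj.singleRegionSplit_holds L 2 (by omega) (fun k => nK L f k * F2 L f k)
  have hout : ∑ k ∈ Fibre3.outer1 L 2, nK L f k * F2 L f k
      = (∑ k ∈ E0, MK L Δ lam2 f k * cK L Δ lam2 f k - ∑ k ∈ BL, MK L Δ lam2 f k * cK L Δ lam2 f k)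
        + ∑ k ∈ Fibre3.outer1 L 2, (nK L f k * F2 L f k - MK L Δ lam2 f k * cK L Δ lam2 f k) := by
    rw [hE0, hBL, ← outer1_sum_eq L (by omega), ← Finset.sum_add_distrib]
    refine Finset.sum_congr rfl fun k _ => ?_; ring
  have hbd := OuterMaj.pc0_outer_bound L (by omega) hΔ0 hΔ1 hf 2 (by omega) (m0 := 13 / 10) (by norm_num)
  dsimp only at hbd
  have hmaj : ∑ k ∈ Fibre3.outer1 L 2, (MK L Δ lam2 f k * (kapHat L Δ lam2 f 2 + 2 * aPar L Δ f * cS L Δ lam2 f / (L : ℝ) ^ 2)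
        * gres L lam2 k
      + ((2 * betaK L Δ lam2 f k * (kapHat L Δ lam2 f 2 + 2 * aPar L Δ f * cS L Δ lam2 f / (L : ℝ) ^ 2) * gres L lam2 k * EK L k
          + tauBar L Δ lam2 f * (betaK L Δ lam2 f k ^ 2 * EK L k / (13 / 10) + 2 * (13 / 10))
          + 8 * qPar L Δ f * (kapHat L Δ lam2 f 2 + 2 * aPar L Δ f * cS L Δ lam2 f / (L : ℝ) ^ 2) * gres L lam2 k
          + 4 * qPar L Δ f * tauBar L Δ lam2 f)
        + (EK L k * (kapHat L Δ lam2 f 2 + 2 * aPar L Δ f * cS L Δ lam2 f / (L : ℝ) ^ 2) ^ 2 * gres L lam2 k ^ 2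
          + 2 * tauBar L Δ lam2 f ^ 2))
        * (2 * cS L Δ lam2 f * gres L lam2 k + dPar L Δ f
          + (kapHat L Δ lam2 f 2 + 2 * aPar L Δ f * cS L Δ lam2 f / (L : ℝ) ^ 2) * gres L lam2 k))
      = kapP L Δ lam2 f * (∑ k ∈ E0, MK L Δ lam2 f k * gres L lam2 k - ∑ k ∈ BL, MK L Δ lam2 f k * gres L lam2 k)
        + (∑ k ∈ E0, YP2 L Δ lam2 f k * acZ L Δ lam2 f k - ∑ k ∈ BL, YP2 L Δ lam2 f k * acZ L Δ lam2 f k) := by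
    rw [hE0, hBL, ← outer1_sum_eq L (by omega), ← outer1_sum_eq L (by omega), Finset.mul_sum, ← Finset.sum_add_distrib]
    refine Finset.sum_congr rfl fun k _ => ?_
    unfold YP2 acZ kapP
    ring
  rw [hmaj] at hbd
  obtain ⟨hlow, hupp⟩ := abs_le.1 hbd
  have hconv : (∑ k ∈ Fibre3.outer1 L 2, (((nnList L).map (fun e => Complex.normSq (phiHat L f e k))).sum * F2 L f k
      - MK L Δ lam2 f k * cK L Δ lam2 f k))
      = ∑ k ∈ Fibre3.outer1 L 2, (nK L f k * F2 L f k - MK L Δ lam2 f k * cK L Δ lam2 f k) := rfl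
  rw [hconv] at hlow hupp
  have key : t ^ 2 * ∑ k : Tor L, nK L f k * F2 L f k
      = t ^ 2 * (nK L f 0 * F2 L f 0) + t ^ 2 * ∑ k ∈ BL, nK L f k * F2 L f k
        + t ^ 2 * (∑ k ∈ E0, MK L Δ lam2 f k * cK L Δ lam2 f k - ∑ k ∈ BL, MK L Δ lam2 f k * cK L Δ lam2 f k)
        + t ^ 2 * ∑ k ∈ Fibre3.outer1 L 2, (nK L f k * F2 L f k - MK L Δ lam2 f k * cK L Δ lam2 f k) := by
    rw [split, hout, hBL]; ring
  have hAB : A + B = t ^ 2 * (kapP L Δ lam2 f * (∑ k ∈ E0, MK L Δ lam2 f k * gres L lam2 k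
      - ∑ k ∈ BL, MK L Δ lam2 f k * gres L lam2 k)
      + (∑ k ∈ E0, YP2 L Δ lam2 f k * acZ L Δ lam2 f k - ∑ k ∈ BL, YP2 L Δ lam2 f k * acZ L Δ lam2 f k)) := by
    rw [hA, hB]; ring
  have hmA := le_max_left A 0
  have hmB := le_max_left B 0
  have hU := mul_le_mul_of_nonneg_left hupp ht2
  have hD := mul_le_mul_of_nonneg_left hlow ht2
  rw [ehi, elo, hzero, eout, etail, key]
  constructor
  · linarith [bLo, hmA, hmB, hD, hAB]
  · linarith [bHi, hmA, hmB, hU, hAB]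

end Summit.HubbardSuperconductivity.HubbardSuperconductivity.Theorems.AnisotropyChord.Transfer.Fibre3.L2.N1
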